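import Summits.BirchSwinnertonDyer.Rank1Residual.O6.KatoLocalIndexTower
import Summits.BirchSwinnertonDyer.BirchSwinnertonDyer.Theorems.Rank1ResidualIntModelReduction
import Literature.NumberTheory.EllipticCurves.CuspidalReductionInfiniteHeightProofs
import Literature.NumberTheory.EllipticCurves.OrdinaryPrimesProofs
import HarnessLib

/-!
# LEMMA A `O6.IntegralLogAdditive` is a THEOREM — `log_W ∈ ℤ_p⟦X⟧` at EVERY additive prime `p` of a
# globally minimal `W/ℚ`, `p = 2` included; with `[p]˜ = 0` (infinite height) and `exp_W ∈ ℤ_p⟦X⟧`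
# (cell `b2b-bsdres`, team n1011, seat p05 GEN 13, ROW T-O6-LOGA under the idle rule; O6 lane = cc-typer-5 /
#  o6-r1 / o6-r2; theorems only)

HONEST FRAMING (cell `b2b-bsdres`, run/shared/lean/b2b/bsd-rank1-residual/, verbatim in every file): the
goal of the cell is to DELETE the COMBINATION-SHAPED residual classes of the Birch–Swinnerton-Dyer formula
for ALL analytic-rank `≤ 1` elliptic curves over `ℚ` — "full BSD formula for every rank `≤ 1` curve in
class `C`" assembled STRICTLY from published theorems — so that the rank-`≤ 1` remainder becomes exactly
the CONSTRUCTION-SHAPED classes, which are TYPED (missing-input `Prop`s), NOT attempted. This is not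
"finishing BSD". Lane CLASS-CLOSURE / teams o5–o6 (O6 OPEN): research routes; census output is
EVIDENCE, never a Literature fact; nothing is booked; no mark of `RESIDUAL-MAP.md` moves. This file:
THEOREMS ONLY (no definition, no named fact, no `@[conjecture]` node, no `sorry`; net named-fact debt
`0`); NO hypothesis beyond the TARGET's own binders; no census number is an input of anything.

## What is proved

* **`O6.integralLogAdditive_holds : IntegralLogAdditive`** — the O6 lane's typed node LEMMA A =
  (T1) of `O6/KatoLocalIndexTower.lean` (cc-typer-5 GEN 11; o6-r1 GEN 16 memo §1, `cells/o5o6/TARGETS.md`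
  §O6 (G16-1)), binders verbatim: for every elliptic, globally minimal `W/ℚ`, every prime `p ≠ 2` with
  `Addv W p`, and every `n`, `‖coeff n (W ⊗ ℚ_p).formalLog‖ ≤ 1`.
* The node is the `p ≠ 2` instance of a lemma valid at EVERY prime, the main theorem of this file:
  **`Additive.norm_coeff_formalLog_baseChange_le_one_of_addv (W) (p) : Addv W p → ∀ n,
  ‖coeff n (W.baseChange ℚ_[p]).formalLog‖ ≤ 1`** — the binder `p ≠ 2` of the node is IDLE (the
  memo's "`p` odd" came from the `E₁ = Ê(pℤ_p)` dictionary of its corollaries, not from the lemma).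
  Companions in the same currency: `Additive.formalMul_prime_map_eq_zero_of_addv` (**infinite height**:
  `[p]˜ = 0` for the reduction mod `p` of the integral model — the memo's "additive ⇒ `Ĝ_a`" in the
  kernel), `Additive.norm_coeff_formalExp_baseChange_le_one_of_addv` (**`exp_W ∈ ℤ_p⟦X⟧`**, so
  `log_W : Xℤ_p⟦X⟧ ⥲ Xℤ_p⟦X⟧` is a bijection of integral series — the power-series half of the memo's
  corollary (a) `log_ω : Ê(𝔪_K) ⥲ 𝔪_K`), `Additive.exists_padicInt_formalLog_subst_eq_of_addv` (the
  free Honda witness), and the integer-data dictionary `Additive.addv_iff_dvd_and_dvd`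
  (`Addv W p ↔ p ∣ Δ_min(W) ∧ p ∣ c₄(W_ℤ)`, Silverman VII.5.1(c) on the integral model).

ROUTE — not a new proof: a kernel corollary of TREE THEOREMS already landed in the Manin-constant lane
of `Literature/NumberTheory/EllipticCurves` (so the node's "WHY A NODE: the tree has `formalLog` over
`ℚ`-algebras but neither the formal group LAW / `[p]`-series over `ℤ_p` nor Honda theory" is STALE —
all three are in the tree): `CuspidalReductionInfiniteHeightProofs` (`norm_coeff_formalLog_le_one_of_dvd_of_dvd`:
`p ∣ Δ_min`, `p ∣ c₄(W_ℤ)` ⟹ `log ∈ ℤ_p⟦X⟧`, every `p`, via `exists_variableChange_eq_zero_of_cuspidal` —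
a cuspidal cubic over `𝔽_p` is `y² = x³` up to `(1, r, s, t)` — and `FormalGroupInfiniteHeightProofs`:
`[n] = nX` on `y² = x³`, `[p] ≡ 0 (mod p) ⟹ log ∈ ℤ_p⟦X⟧` (Honda 1970 Thm. 2), inverse-function
integrality for `exp`), composed with the `Addv` ↔ integer-data bridge (`hasGoodReductionAtPrime_of_not_dvd`,
`IntModel.hasMultiplicativeReductionAtPrime_of_intModel`, `addv_of_intModel`; pattern of
`Additive.three_dvd_c₄_of_addv`). `O6/KatoLocalIndexTower.lean` is UNTOUCHED: its doc-only "(T1) TARGET ↦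
THEOREM" restamp and the readings of `cells/o5o6/TARGETS.md` are the typer's / the O6 planners' (the
EVIDENCE block — logint `= 0` on 36/36, 78/78 row-levels — stays EVIDENCE). WORDING offered (EVIDENCE
framing): "(T1) LEMMA A `IntegralLogAdditive` is a THEOREM — indeed `log_{W ⊗ ℚ_p} ∈ ℤ_p⟦X⟧`, `[p]˜ = 0` and
`exp_{W ⊗ ℚ_p} ∈ ℤ_p⟦X⟧` at EVERY additive prime `p` of a globally minimal `W/ℚ`, `p = 2, 3` included, by the
tree's cuspidal-infinite-height theorems; nothing booked; no mark."

References: T. Honda, *On the theory of commutative formal groups*, J. Math. Soc. Japan 22 (1970) §2, Thm. 2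
(p. 223) [Honda1970]; J. H. Silverman, *The Arithmetic of Elliptic Curves*, GTM 106 (2009), III.2.5 (`E_ns ≅ 𝔾_a`
at a cusp), IV.1–IV.6, VII.5 Prop. 5.1 (c) [SilvermanAEC2009]; o6-r1 GEN 16 memo
`HOME/b2b-bsdres-o6-r1/gen16/O6-GEN16.md` §1 (Lemma A, proofs 1–2, corollaries (a)–(d)).
-/

noncomputable section

open scoped Classical

open IsDedekindDomain NumberField Rat.HeightOneSpectrum WeierstrassCurve PowerSeries
  Literature.NumberTheory.EllipticCurves Literature.NumberTheory.EllipticCurves.Rank1Residual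
  Summit.BirchSwinnertonDyer.BirchSwinnertonDyer.Rank1Residual.IntModel

namespace Summit.BirchSwinnertonDyer.Rank1Residual.Additive

/-! ## §1 `Addv` read on the integral model: `p ∣ Δ_min` and `p ∣ c₄` (every `p`) -/

section IntegerData

variable (W : WeierstrassCurve ℚ) [W.IsElliptic] [W.IsGloballyMinimal] (p : ℕ) [hp : Fact p.Prime]

omit [W.IsElliptic] in
/-- Bad (not good) reduction at `p` gives `p ∣ Δ_min(W)` (Silverman VII.1 Remark 1.1 / VII.5.1 (a):
`p ∤ Δ_min` is good reduction, tree `hasGoodReductionAtPrime_of_not_dvd`).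
[cite: SilvermanAEC2009, VII.5 Prop. 5.1 (a)] -/
theorem dvd_minimalDiscriminantInt_of_not_good (hbad : ¬ W.HasGoodReductionAtPrime p) :
    (p : ℤ) ∣ minimalDiscriminantInt W := by
  by_contra h
  exact hbad (hasGoodReductionAtPrime_of_not_dvd W p h)

/-- **Additive reduction at `p` gives `p ∣ c₄(W_ℤ)`** (else `p ∣ Δ_min`, `p ∤ c₄` would be
multiplicative reduction, Silverman VII.5.1 (b); tree `IntModel.hasMultiplicativeReductionAtPrime_of_intModel`).
[cite: SilvermanAEC2009, VII.5 Prop. 5.1 (b)–(c)] -/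
theorem dvd_c₄_of_addv (hadd : Addv W p) : (p : ℤ) ∣ (integralModelInt W).c₄ := by
  by_contra h
  refine hadd.2 (hasMultiplicativeReductionAtPrime_of_intModel (W := W) rfl p ?_ h)
  rw [← minimalDiscriminantInt_eq (W := W) rfl]
  exact dvd_minimalDiscriminantInt_of_not_good W p hadd.1

/-- **`Addv W p ↔ p ∣ Δ_min(W) ∧ p ∣ c₄(W_ℤ)`**: the cell's atom `Addv` (neither good nor multiplicative)
read on the integer data of the globally minimal model (Silverman VII.5.1 (c): additive iff `v(Δ) > 0`,
`v(c₄) > 0` on a minimal equation; tree `addv_of_intModel` for `←`). [cite: SilvermanAEC2009, VII.5 Prop. 5.1 (c)] -/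
theorem addv_iff_dvd_and_dvd :
    Addv W p ↔ (p : ℤ) ∣ minimalDiscriminantInt W ∧ (p : ℤ) ∣ (integralModelInt W).c₄ := by
  refine ⟨fun hadd ↦ ⟨dvd_minimalDiscriminantInt_of_not_good W p hadd.1, dvd_c₄_of_addv W p hadd⟩,
    fun h ↦ ?_⟩
  -- the `←` direction is `Additive.addv_of_intModel` (X4ThreeResCertKernel); re-derived here to keep the
  -- O6 import closure free of the X4 records chain
  obtain ⟨hΔ, hc₄⟩ := h
  set v : HeightOneSpectrum (𝓞 ℚ) := (primesEquiv (R := 𝓞 ℚ)).symm ⟨p, hp.out⟩ with hvdef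
  have hv : primesEquiv v = ⟨p, hp.out⟩ := Equiv.apply_symm_apply _ _
  haveI : Fact (primesEquiv v : ℕ).Prime := ⟨(primesEquiv v).2⟩
  have hadd : W.HasAdditiveReductionAt v := by
    rw [hasAdditiveReductionAt_iff_of_isMinimalAt (IsGloballyMinimal.isMinimal (W := W) v),
      Δ_eq_cast (W := W) rfl, c₄_eq_cast (W := W) rfl, (valuation_equiv_padicValuation v).lt_one_iff_lt_one,
      (valuation_equiv_padicValuation v).lt_one_iff_lt_one, Rat.padicValuation_cast,
      Rat.padicValuation_cast, Int.padicValuation_lt_one_iff, Int.padicValuation_lt_one_iff, hv]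
    exact ⟨hΔ, hc₄⟩
  have key : ∀ q' : Nat.Primes, primesEquiv v = q' →
      (haveI := Fact.mk q'.2;
        ¬ W.HasGoodReductionAtPrime (q' : ℕ) ∧ ¬ W.HasMultiplicativeReductionAtPrime (q' : ℕ)) := by
    rintro q' rfl
    exact ⟨fun h ↦ hadd.not_hasGoodReductionAt
        ((hasGoodReductionAtPrime_iff_hasGoodReductionAt_ringOfIntegers v W).mp h),
      fun h ↦ hadd.not_hasMultiplicativeReductionAt
        ((hasMultiplicativeReductionAtPrime_iff_hasMultiplicativeReductionAt_ringOfIntegers W v).mp h)⟩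
  exact key ⟨p, hp.out⟩ hv

end IntegerData

/-! ## §2 Infinite height, integral `log` and integral `exp` at every additive prime -/

section FormalGroup

variable (W : WeierstrassCurve ℚ) [W.IsElliptic] [W.IsGloballyMinimal] (p : ℕ) [hp : Fact p.Prime]

/-- **Infinite height at an additive prime**: for the globally minimal `W/ℚ` with `Addv W p`, the
multiplication-by-`p` series of the reduction mod `p` of its integral model VANISHES, `[p]˜ = 0` — the
formal group of the cuspidal fibre is `Ĝ_a` (Silverman III.2.5), every `p`.
[cite: SilvermanAEC2009, VII.5 Prop. 5.1 (c) and Prop. III.2.5] -/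
theorem formalMul_prime_map_eq_zero_of_addv (hadd : Addv W p) :
    ((integralModelInt W).map (Int.castRingHom (ZMod p))).formalMul p = 0 :=
  W.formalMul_prime_map_toZMod_eq_zero_of_dvd_of_dvd
    (dvd_minimalDiscriminantInt_of_not_good W p hadd.1) (dvd_c₄_of_addv W p hadd)

/-- **LEMMA A at EVERY prime: `log_{W ⊗ ℚ_p} ∈ ℤ_p⟦X⟧` at an additive prime.** For the globally minimal
`W/ℚ` with `Addv W p` (any prime `p`, `2` and `3` included), every coefficient of the formal logarithm of
`W ⊗ ℚ_p` has `p`-adic norm `≤ 1` (Honda: at infinite height the formal group over the unramified `ℤ_p` is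
of type `p`, strongly isomorphic to `Ĝ_a`). [cite: Honda1970, Thm. 2 (p. 223)]
[cite: SilvermanAEC2009, VII.5 Prop. 5.1 (c)] -/
theorem norm_coeff_formalLog_baseChange_le_one_of_addv (hadd : Addv W p) (n : ℕ) :
    ‖coeff n (W.baseChange ℚ_[p]).formalLog‖ ≤ 1 :=
  W.norm_coeff_formalLog_le_one_of_dvd_of_dvd
    (dvd_minimalDiscriminantInt_of_not_good W p hadd.1) (dvd_c₄_of_addv W p hadd) n

/-- **`exp_{W ⊗ ℚ_p} ∈ ℤ_p⟦X⟧` at an additive prime** (inverse-function integrality at infinite height):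
with `log` this makes `log_W : Xℤ_p⟦X⟧ → Xℤ_p⟦X⟧` a bijection of INTEGRAL series with integral inverse —
the power-series content of the memo's corollary (a) `log_ω : Ê(𝔪_K) ⥲ 𝔪_K` for every complete `K/ℚ_p`.
[cite: Honda1970, Thm. 2 (p. 223)] -/
theorem norm_coeff_formalExp_baseChange_le_one_of_addv (hadd : Addv W p) (n : ℕ) :
    ‖coeff n (W.baseChange ℚ_[p]).formalExp‖ ≤ 1 := by
  have h := ((integralModelInt W).map (Int.castRingHom ℤ_[p])).norm_coeff_formalExp_le_one_of_formalMul_prime_eq_zero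
    (by rw [map_toZMod_integralModelInt]; exact formalMul_prime_map_eq_zero_of_addv W p hadd) n
  rwa [map_coe_integralModelInt] at h

/-- **The Honda witness is free at an additive prime**: every `ℓ₂ ∈ Xℤ_p⟦X⟧` is `log_{W ⊗ ℚ_p}(ψ)` for
some `ψ ∈ Xℤ_p⟦X⟧` (namely `exp_W(ℓ₂)`). [cite: Honda1970, Thm. 2 (p. 223)] -/
theorem exists_padicInt_formalLog_subst_eq_of_addv (hadd : Addv W p) {ℓ₂ : ℚ_[p]⟦X⟧}
    (hℓ0 : constantCoeff ℓ₂ = 0) (hℓ : ∀ n, ‖coeff n ℓ₂‖ ≤ 1) :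
    ∃ ψ : ℚ_[p]⟦X⟧, constantCoeff ψ = 0 ∧ (∀ n, ‖coeff n ψ‖ ≤ 1) ∧
      (W.baseChange ℚ_[p]).formalLog.subst ψ = ℓ₂ := by
  have h := ((integralModelInt W).map (Int.castRingHom ℤ_[p])).exists_padicInt_formalLog_subst_eq_of_formalMul_prime_eq_zero
    (by rw [map_toZMod_integralModelInt]; exact formalMul_prime_map_eq_zero_of_addv W p hadd) hℓ0 hℓ
  rwa [map_coe_integralModelInt] at h

end FormalGroup

end Summit.BirchSwinnertonDyer.Rank1Residual.Additive

namespace Summit.BirchSwinnertonDyer.Rank1Residual.O6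

open Summit.BirchSwinnertonDyer.Rank1Residual.Additive

/-! ## §3 The O6 lane's node (T1) LEMMA A, binders verbatim -/

/-- **(T1) LEMMA A `IntegralLogAdditive` HOLDS**: for every elliptic, globally minimal `W/ℚ`, every odd
prime `p` of additive reduction and every `n`, `‖coeff n (W ⊗ ℚ_p).formalLog‖ ≤ 1` — the O6 lane's
`@[conjecture]` THEOREM-CANDIDATE of `O6/KatoLocalIndexTower.lean` is a theorem (the binder `p ≠ 2` is not
used: `Additive.norm_coeff_formalLog_baseChange_le_one_of_addv`). [cite: Honda1970, Thm. 2 (p. 223)]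
[cite: SilvermanAEC2009, VII.5 Prop. 5.1 (c)] -/
theorem integralLogAdditive_holds : IntegralLogAdditive := by
  intro W _ _ p _ _ hadd n
  exact norm_coeff_formalLog_baseChange_le_one_of_addv W p hadd n

/-- **LEMMA A on class O6** (`ClassO6 W 3 = 3 ≠ 2 ∧ Addv W 3 ∧ SubW W 3`): the formal logarithm of
`W ⊗ ℚ₃` of an O6 curve is `3`-integral. [cite: Honda1970, Thm. 2 (p. 223)] -/
theorem norm_coeff_formalLog_le_one_of_classO6 (W : WeierstrassCurve ℚ) [W.IsElliptic] [W.IsGloballyMinimal]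
    [Fact (Nat.Prime 3)] (hO6 : ClassO6 W 3) (n : ℕ) :
    ‖coeff n (W.baseChange ℚ_[3]).formalLog‖ ≤ 1 :=
  norm_coeff_formalLog_baseChange_le_one_of_addv W 3 hO6.2.1 n

end Summit.BirchSwinnertonDyer.Rank1Residual.O6
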